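import Literature.Computability.FineGrained.OVFromSETH
import HarnessLib
import HarnessLib.Audit

/-!
# SETH ⇒ no strongly subquadratic edit distance (fine-grained.S14): decomposition of the printed
theorem

Companion to `Literature.Computability.FineGrained.SETHHardness` for **fine-grained.S14**
(`not_editDistance_inTimeO_of_sethWordRAM`: assuming word-RAM SETH, for every `ε > 0` the edit
distance of two *binary* strings of total length `n` has no deterministic `O(n^{2-ε})`-time
word-RAM algorithm). Sources:

* A. Backurs, P. Indyk, *Edit distance cannot be computed in strongly subquadratic time (unless
  SETH is false)*, STOC 2015 (arXiv:1412.0348). Architecture of the proof (numbering of the arXiv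
  version): §2 ("It is known [Williams 2005] that an `O(N^{2-δ} d^{O(1)})`-time algorithm for OVP
  would imply that SETH is false. Therefore, in what follows we focus on reducing the Orthogonal
  Vectors problem to the Edit Distance problem"); §3.1 vector gadgets over `{0,1,2}`, Lemmas 1–2;
  §3.2 Thm. 1 (`PATTERN`); §3.3 Thm. 2 (`EDIT` over `{0,1,2,3}`) and **Thm. 3**: "If `EDIT` can be
  computed in time `O(n^{2-δ})` for some `δ > 0` on two sequences of length `n` over an alphabet
  of size `4`, then OV with `|A| = |B| = N` and `A, B ⊆ {0,1}^d` can be solved in time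
  `d^{O(1)} · N^{2-δ}`."
* K. Bringmann, M. Künnemann, *Quadratic conditional lower bounds for string problems and dynamic
  time warping*, FOCS 2015 (arXiv:1502.01063): Thm. 1.2 (edit distance on **binary** strings has
  no `O(n^{2-ε})` algorithm unless SETH fails — the alphabet of `Cryptography.EditDistance`);
  §2.1, hypothesis **OVH** ("for no `ε > 0` there is an algorithm for OV, restricted to `n = m`,
  that runs in time `O(n^{2-ε} poly(d))`") and **Lemma 2.1** (SETH implies OVH, "follows from
  [Williams 2005]"); §3, Thm. 3.3 and its proof in §3.1 (the generic reduction OV → `δ` for a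
  similarity measure `δ` admitting an alignment gadget and coordinate values: strings of length
  `O((n+m) d)` built in time `O((n+m) d)`, one evaluation of `δ`, one comparison with a threshold);
  §5.2, Lemma 5.2 (coordinate values `1ₓ = 11100`, `0ₓ = 10011`, `1_y = 00111`, `0_y = 11001`)
  and Lemmas 5.3–5.4 (the alignment gadget for `EDIT(c_subst)` on binary strings; Levenshtein
  distance is `c_subst = 1`).
* R. Williams, *A new algorithm for optimal 2-constraint satisfaction and its implications*,
  TCS 348 (2005), §5.1 / Thm. 5.1 (split and list: CNF-SAT on `n` variables and `m` clauses from
  OV with `N = 2^{n/2}` vectors of dimension `d = m`, in time `f(m) · 2^{(1-ε/2) n}` given an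
  `f(d) · N^{2-ε}` OV algorithm).

## Decomposition

The printed proof of S14 is "SETH ⇒ OVH" (Williams) followed by "subquadratic binary edit
distance ⇒ ¬ OVH" (Backurs–Indyk for alphabet size `4`, Bringmann–Künnemann for size `2`), both
in the one machine model of the sources, the word RAM (`Cryptography.WordRAM`,
`FGProblem.InTimeInst`). Accordingly:

* `OVInTimePolyDim ε` — OV (`Cryptography.OV`: `n` vectors per list, dimension `d`, both lists of
  the same length as in OVH) is decided on the deterministic word RAM within
  `C · (n+1)^{2-ε} · (d+1)^c` steps for some constants `C, c`; `OVHWordRAM := ∀ ε > 0,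
  ¬ OVInTimePolyDim ε` is OVH of BK15, §2.1 in the word-RAM model (a hypothesis, never asserted).
* `kSATInRAMTime_of_ovInTimePolyDim` (**named fact**, Williams 2005, Thm. 5.1; the proof of BK15,
  Lemma 2.1): an OV algorithm in time `O((n+1)^{2-ε} (d+1)^c)`, `0 < ε ≤ 1`, gives `k`-SAT in
  word-RAM time `O(2^{δ n})` for every `k` and every `δ > 1 - ε/2` — *no sparsification is needed*,
  because a `k`-CNF without repeated clauses has `poly(n)` clauses, absorbed by `(d+1)^c` and the
  slack in `δ`. Its consequence `ovhWordRAM_of_sethWordRAM` (BK15, Lemma 2.1: SETH ⇒ OVH) is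
  derived (`ovhWordRAM_of_sethWordRAM_of`), and is also derived from the deterministic OV
  conjecture in dimension `c log n` (`ovhWordRAM_of_ovConjectureDet`: an `O(n^{2-ε} poly(d))`
  algorithm is an `O(n^{2-ε/2})` algorithm when `d = c log n`), hence from fine-grained.S09
  (`ovhWordRAM_of_sethWordRAM_of_ovConjectureDet`).
* `ovInTimePolyDim_of_editDistance_inTimeO` (**named fact**, BI15 Thm. 3 for the architecture,
  BK15 Thm. 3.3 + Lemmas 5.2/5.4 for the binary alphabet): a deterministic `O(n^{2-ε})` word-RAM
  algorithm for binary edit distance (`0 < ε ≤ 1`) yields `OVInTimePolyDim ε`.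
* **Assembly (proved):** `not_editDistance_inTimeO_of_ovhWordRAM` (BK15 Thm. 1.2 with SETH
  replaced by OVH, as allowed by BK15 §2.1) and `not_editDistance_inTimeO_of_sethWordRAM_of`:
  the two named facts imply `not_editDistance_inTimeO_of_sethWordRAM` verbatim (shrink the given
  `ε` to `min ε 1` first: an `O(n^{2-ε})` algorithm is an `O(n^{2 - min ε 1})` one).

What remains for `not_editDistance_inTimeO_of_sethWordRAM_holds` (tracked in the literature
prover's notes): (i) the combinatorial core of BK15 for Levenshtein distance on `{0,1}` — explicit
gadget strings `x(A,B)`, `y(A,B)` and a threshold `ρ(n,d)` with `editDist x y ≤ ρ ↔` an orthogonal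
pair exists (BK15 §3.1 Claims 3.4–3.6 over the alignment gadget of Lemma 5.4 and the coordinate
values of Lemma 5.2); (ii) a word-RAM program writing these strings and running the hypothetical
edit-distance program as an emulated sub-run (toolkit of `CliqueETHReductionProgram.lean`), which
proves `ovInTimePolyDim_of_editDistance_inTimeO`; (iii) the split-and-list program with an
emulated OV sub-run, which proves `kSATInRAMTime_of_ovInTimePolyDim`.

## Design choices

* `OVInTimePolyDim` renders "`O(n^{2-ε} poly(d))`" (BK15 §2.1) / "`d^{O(1)} · N^{2-δ}`" (BI15
  Thm. 3) as the per-instance step bound `⌊C · ((n+1)^{2-ε} · (d+1)^c)⌋₊` (`FGProblem.InTimeInst`,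
  word size `k · OV.width I` as everywhere in the zoo). The shifts `n+1`, `d+1` make the bound at
  least `C` on the degenerate instances `n = 0` (no vectors) and `d = 0` (every pair orthogonal),
  which print's asymptotic notation ignores; for `n, d ≥ 1` they change the bound by a factor of
  at most `2^{2+c}`, absorbed by `C`. With base `n+1 ≥ 1` the bound is antitone in `ε`
  (`OVInTimePolyDim.anti`), which the assembly uses to shrink `ε` below `1`.
* Both named facts carry `ε ≤ 1`: a sublinear-time bound cannot even read the instance, and the
  reductions spend `Θ(N d)` (resp. `Θ(n 2^{n/2})`) steps writing the derived instance, so print's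
  "for some `δ > 0`" is used, as in print, only for small `δ`; the assembled theorems quantify over
  every `ε > 0` by first shrinking it (`inTimeO_rpow_two_sub_anti`). The same convention is used by
  `sparseKSATInRAMTime_of_ov_subquadratic` (`OVFromSETH.lean`).
* Nothing here uses Wave0's Turing-machine `SETH`: hypothesis and conclusion live in the word RAM
  (see the module docstring of `SETHHardness.lean`, "Machine models").
-/

namespace Literature.Computability.FineGrained

open Cryptography Cryptography.WordRAM

/-! ### OV in time `O(n^{2-ε} · poly(d))` on the word RAM, and OVH -/

/-- `OVInTimePolyDim ε`: Orthogonal Vectors (`Cryptography.OV`: two lists of `n` Boolean vectors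
of dimension `d`, accept `[1]` iff some pair is orthogonal) is decided by a deterministic
oracle-free word-RAM program within `⌊C · ((n+1)^{2-ε} · (d+1)^c)⌋₊` steps on every instance, for
some constants `C : ℝ`, `c : ℕ` — the running time "`O(n^{2-ε} poly(d))`" of hypothesis OVH
(Bringmann–Künnemann, FOCS 2015, §2.1), "`d^{O(1)} · N^{2-δ}`" in Backurs–Indyk, STOC 2015,
Thm. 3. The shifts `n+1`, `d+1` only absorb the degenerate instances `n = 0`, `d = 0` (module
docstring, "Design choices"). [cite: BringmannKunnemannFOCS2015, §2.1 (hypothesis OVH)] -/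
def OVInTimePolyDim (ε : ℝ) : Prop :=
  ∃ (C : ℝ) (c : ℕ), OV.InTimeInst fun I : OVInstance =>
    ⌊C * ((((I.n : ℝ) + 1) ^ (2 - ε)) * ((I.d : ℝ) + 1) ^ c)⌋₊

/-- HYPOTHESIS **OVH** on the deterministic word RAM (Bringmann–Künnemann, FOCS 2015, §2.1: "For no
`ε > 0` there is an algorithm for OV, restricted to `n = m`, that runs in time
`O(n^{2-ε} poly(d))`"; R. Williams, TCS 348 (2005), §5; Backurs–Indyk, STOC 2015, §2). A
conjecture — implied by word-RAM SETH (`ovhWordRAM_of_sethWordRAM`) and by the deterministic OV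
conjecture in dimension `c log n` (`ovhWordRAM_of_ovConjectureDet`) — used only as a hypothesis or
as a conclusion, never asserted. [cite: BringmannKunnemannFOCS2015, §2.1 (hypothesis OVH)] -/
@[conjecture] def OVHWordRAM : Prop :=
  ∀ ε : ℝ, 0 < ε → ¬ OVInTimePolyDim ε

/-- `OVInTimePolyDim` is antitone in the saving `ε`: an `O((n+1)^{2-ε} (d+1)^c)` bound is an
`O((n+1)^{2-ε'} (d+1)^c)` bound for `ε' ≤ ε` (same program; the base `n + 1` is at least `1`).
[folklore] -/
theorem OVInTimePolyDim.anti {ε ε' : ℝ} (h : OVInTimePolyDim ε) (hε : ε' ≤ ε) :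
    OVInTimePolyDim ε' := by
  obtain ⟨C, c, hC⟩ := h
  refine ⟨max C 0, c, hC.mono fun I => Nat.floor_le_floor ?_⟩
  have h1 : (1 : ℝ) ≤ (I.n : ℝ) + 1 := by
    have := (Nat.cast_nonneg I.n : (0 : ℝ) ≤ I.n); linarith
  have hd : (0 : ℝ) ≤ ((I.d : ℝ) + 1) ^ c := by positivity
  have hpow : ((I.n : ℝ) + 1) ^ (2 - ε) ≤ ((I.n : ℝ) + 1) ^ (2 - ε') :=
    Real.rpow_le_rpow_of_exponent_le h1 (by linarith)
  have hp0 : (0 : ℝ) ≤ ((I.n : ℝ) + 1) ^ (2 - ε) := Real.rpow_nonneg (by linarith) _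
  calc C * (((I.n : ℝ) + 1) ^ (2 - ε) * ((I.d : ℝ) + 1) ^ c)
      ≤ max C 0 * (((I.n : ℝ) + 1) ^ (2 - ε) * ((I.d : ℝ) + 1) ^ c) :=
        mul_le_mul_of_nonneg_right (le_max_left _ _) (mul_nonneg hp0 hd)
    _ ≤ max C 0 * (((I.n : ℝ) + 1) ^ (2 - ε') * ((I.d : ℝ) + 1) ^ c) :=
        mul_le_mul_of_nonneg_left (mul_le_mul_of_nonneg_right hpow hd) (le_max_right _ _)

/-! ### SETH ⇒ OVH (Williams' split-and-list, polynomial dimension) -/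

/-- **Williams' split-and-list reduction on the word RAM, polynomial dimension (named fact).**
If for some `0 < ε ≤ 1` Orthogonal Vectors is decided on the deterministic word RAM in time
`O((n+1)^{2-ε} (d+1)^c)` (`OVInTimePolyDim ε`), then for every width `k` and every exponent
`δ > 1 - ε/2`, `k`-SAT (`kSATProblem k`: width `≤ k`, no repeated clause, `n = numVars`) is decided
on the deterministic word RAM in time `O(2^{δ n})` (`KSATInRAMTime k δ`). Printed form: R. Williams,
TCS 348 (2005), §5.1, Thm. 5.1 (Theorem 5 of the author's version): an `f(d) · N^{2-ε}`-time
algorithm for cooperative subset queries / OV on `N` vectors of dimension `d` gives CNF-SAT on `n`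
variables and `m` clauses in time `f(m) · 2^{(1-ε/2) n}` up to polynomial factors — split the
variables into two halves, list the `N = 2^{⌈n/2⌉}` assignments of each half as vectors
`u_p, v_q ∈ {0,1}^m` with `u_p[j] = 0` iff `p` satisfies clause `j` (resp. `v_q[j] = 0` iff `q`
does), so that `⟨u_p, v_q⟩ = 0` iff `(p, q)` satisfies the formula, and run the OV algorithm once
(here: as an emulated sub-run at its own word size). This is the proof of Bringmann–Künnemann,
FOCS 2015, Lemma 2.1 ("SETH implies OVH … follows from [Williams 2005]") and the reduction quoted
by Backurs–Indyk, STOC 2015, §2. For `k`-CNFs without repeated clauses `m ≤ ∑_{j ≤ k} (2n)^j`, so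
`f(m) = (m+1)^c` is polynomial in `n` and, together with the `O(N · m · k)` construction cost, is
absorbed by any `δ > 1 - ε/2 ≥ 1/2`: **no sparsification lemma is needed** (contrast
`sparseKSATInRAMTime_of_ov_subquadratic`, where `d = c log N` forces `m = O(n)`). `ε ≤ 1` as in
that fact (the construction alone costs `n 2^{n/2}`).
[cite: WilliamsTCS2005, §5.1 Thm. 5.1] [cite: BringmannKunnemannFOCS2015, Lemma 2.1 (proof)] -/
def kSATInRAMTime_of_ovInTimePolyDim : Prop :=
  ∀ ε : ℝ, 0 < ε → ε ≤ 1 → OVInTimePolyDim ε →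
    ∀ (k : ℕ) (δ : ℝ), 1 - ε / 2 < δ → KSATInRAMTime k δ

/-- **SETH ⇒ OVH on the word RAM (named fact).** Bringmann–Künnemann, FOCS 2015, Lemma 2.1
("SETH implies OVH"; "For OVH the statement follows from [Williams 2005]"): word-RAM SETH
(`SETHWordRAM`) implies that for no `ε > 0` is OV in deterministic word-RAM time
`O((n+1)^{2-ε} (d+1)^c)` (`OVHWordRAM`). Derived below from Williams' reduction
(`ovhWordRAM_of_sethWordRAM_of`) and, independently, from fine-grained.S09
(`ovhWordRAM_of_sethWordRAM_of_ovConjectureDet`).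
[cite: BringmannKunnemannFOCS2015, Lemma 2.1] [cite: WilliamsTCS2005, §5.1 Thm. 5.1] -/
def ovhWordRAM_of_sethWordRAM : Prop :=
  SETHWordRAM → OVHWordRAM

/-- Williams' split-and-list reduction (`kSATInRAMTime_of_ovInTimePolyDim`) gives SETH ⇒ OVH on the
word RAM (Bringmann–Künnemann, FOCS 2015, Lemma 2.1): an `O((n+1)^{2-ε}(d+1)^c)` OV algorithm,
`ε` shrunk to `ε₁ = min ε 1`, puts every `k`-SAT in time `O(2^{(1 - ε₁/4) n})`, contradicting
`SETHWordRAM` at `ε₁/4`. [cite: BringmannKunnemannFOCS2015, Lemma 2.1] -/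
theorem ovhWordRAM_of_sethWordRAM_of (h : kSATInRAMTime_of_ovInTimePolyDim) :
    ovhWordRAM_of_sethWordRAM := by
  intro hSETH ε hε hov
  set ε₁ : ℝ := min ε 1 with hε₁
  have hε₁pos : 0 < ε₁ := lt_min hε one_pos
  have hε₁le : ε₁ ≤ 1 := min_le_right _ _
  have hov₁ : OVInTimePolyDim ε₁ := hov.anti (min_le_left _ _)
  obtain ⟨k, -, hk⟩ := hSETH (ε₁ / 4) (by positivity)
  exact hk (h ε₁ hε₁pos hε₁le hov₁ k (1 - ε₁ / 4) (by linarith))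

/-! ### OVH from the OV conjecture in dimension `c log n` -/

/-- For `0 < η ≤ 1` and `L : ℕ`: `L + 1 ≤ 2^{η L} / (η log 2)`, from `1 + x ≤ exp x`. [folklore] -/
theorem nat_add_one_le_two_rpow_div {η : ℝ} (hη : 0 < η) (hη1 : η ≤ 1) (L : ℕ) :
    (L : ℝ) + 1 ≤ (2 : ℝ) ^ (η * L) / (η * Real.log 2) := by
  have hlog2 : 0 < Real.log 2 := Real.log_pos one_lt_two
  have hlog2le : Real.log 2 ≤ 1 := by
    have := Real.log_two_lt_d9; linarith
  have hden : 0 < η * Real.log 2 := mul_pos hη hlog2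
  rw [le_div_iff₀ hden]
  have hexp : (2 : ℝ) ^ (η * L) = Real.exp (η * L * Real.log 2) := by
    rw [Real.rpow_def_of_pos two_pos]; ring_nf
  rw [hexp]
  have h1 : η * ↑L * Real.log 2 + 1 ≤ Real.exp (η * ↑L * Real.log 2) := Real.add_one_le_exp _
  have hL : (0 : ℝ) ≤ L := Nat.cast_nonneg L
  have h2 : η * Real.log 2 ≤ 1 := by nlinarith
  nlinarith [h1, h2, hL, hden]

/-- An `O((n+1)^{2-ε} (d+1)^c)`-time OV algorithm (`0 < ε ≤ 1`) is, on the instances of dimension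
`d = c₀ ⌊log₂ n⌋` (`OVWithDim c₀`, same encoding and word size), an `O(n^{2-ε/2})`-time algorithm:
`(c₀ ⌊log₂ n⌋ + 1)^c = O(n^{ε/2})`. [folklore] -/
theorem ovWithDim_inTimeO_of_ovInTimePolyDim {ε : ℝ} (hε : 0 < ε) (hε1 : ε ≤ 1)
    (h : OVInTimePolyDim ε) (c₀ : ℕ) :
    (OVWithDim c₀).InTimeO fun n => (n : ℝ) ^ (2 - ε / 2) := by
  obtain ⟨C, c, M, k, hdet, hof, hM⟩ := h
  -- the constant: `K = ((c₀+1) / (η log 2))^c` with `η = ε / (2 (c+1))`, times `2^{2-ε}`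
  set η : ℝ := ε / (2 * (c + 1)) with hη
  have hc1 : (0 : ℝ) < c + 1 := by positivity
  have hηpos : 0 < η := by positivity
  have hη1 : η ≤ 1 := by
    rw [hη, div_le_one (by positivity)]; nlinarith
  have hlog2 : 0 < Real.log 2 := Real.log_pos one_lt_two
  set K : ℝ := (((c₀ : ℝ) + 1) / (η * Real.log 2)) ^ c with hK
  have hKpos : 0 < K := by positivity
  set C' : ℝ := max C 0 * (2 : ℝ) ^ (2 - ε) * K + max C 0 with hC'
  refine ⟨C', M, k, hdet, hof, fun I => ?_⟩
  obtain ⟨out, hout, hrun⟩ := hM I.1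
  refine ⟨out, hout, hrun.mono (Nat.floor_le_floor ?_)⟩
  -- notation
  have hI : I.1.d = c₀ * Nat.log 2 I.1.n := I.2
  simp only [OVWithDim, FGProblem.restrict_size, OV_size]
  set n : ℕ := I.1.n with hn
  set L : ℕ := Nat.log 2 n with hL
  have hM0 : 0 ≤ max C 0 := le_max_right _ _
  have hCle : C ≤ max C 0 := le_max_left _ _
  have hbase1 : (1 : ℝ) ≤ (n : ℝ) + 1 := by
    have := (Nat.cast_nonneg n : (0 : ℝ) ≤ n); linarith
  have hp0 : (0 : ℝ) ≤ ((n : ℝ) + 1) ^ (2 - ε) := Real.rpow_nonneg (by linarith) _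
  have hd0 : (0 : ℝ) ≤ ((I.1.d : ℝ) + 1) ^ c := by positivity
  -- Step 0: replace `C` by `max C 0`.
  have step0 : C * (((n : ℝ) + 1) ^ (2 - ε) * ((I.1.d : ℝ) + 1) ^ c) ≤
      max C 0 * (((n : ℝ) + 1) ^ (2 - ε) * ((I.1.d : ℝ) + 1) ^ c) :=
    mul_le_mul_of_nonneg_right hCle (mul_nonneg hp0 hd0)
  refine step0.trans ?_
  rcases Nat.eq_zero_or_pos n with hn0 | hnpos
  · -- `n = 0`: then `L = 0`, `d = 0`, the bound is `max C 0 ≤ C'`.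
    have hL0 : L = 0 := by rw [hL, hn0]; simp
    have hd : I.1.d = 0 := by rw [hI, hL0, mul_zero]
    rw [hd, hn0]
    simp only [Nat.cast_zero, zero_add, Real.one_rpow, one_pow, mul_one]
    have : (0 : ℝ) ≤ max C 0 * (2 : ℝ) ^ (2 - ε) * K := by positivity
    have h0 : (0 : ℝ) ≤ C' * (0 : ℝ) ^ (2 - ε / 2) := by
      have : (0 : ℝ) ^ (2 - ε / 2) = 0 := Real.zero_rpow (by linarith)
      rw [this, mul_zero]
    linarith
  · -- `n ≥ 1`.
    have hn1 : (1 : ℝ) ≤ n := by exact_mod_cast hnpos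
    have hnpos' : (0 : ℝ) < n := by linarith
    -- (a) `(n+1)^{2-ε} ≤ 2^{2-ε} n^{2-ε}`
    have ha : ((n : ℝ) + 1) ^ (2 - ε) ≤ (2 : ℝ) ^ (2 - ε) * (n : ℝ) ^ (2 - ε) := by
      rw [← Real.mul_rpow (by norm_num) (by linarith)]
      exact Real.rpow_le_rpow (by linarith) (by linarith) (by linarith)
    -- (b) `L + 1 ≤ n^η / (η log 2)` since `2^L ≤ n`
    have hpowL : (2 : ℝ) ^ (L : ℝ) ≤ n := by
      have h2L : 2 ^ L ≤ n := by
        rw [hL]; exact Nat.pow_log_le_self 2 (by omega)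
      have : ((2 ^ L : ℕ) : ℝ) ≤ n := by exact_mod_cast h2L
      simpa [Real.rpow_natCast] using this
    have hb : (L : ℝ) + 1 ≤ (n : ℝ) ^ η / (η * Real.log 2) := by
      have h1 := nat_add_one_le_two_rpow_div hηpos hη1 L
      have h2 : (2 : ℝ) ^ (η * L) ≤ (n : ℝ) ^ η := by
        have : (2 : ℝ) ^ (η * L) = ((2 : ℝ) ^ (L : ℝ)) ^ η := by
          rw [← Real.rpow_mul (by norm_num), mul_comm]
        rw [this]
        exact Real.rpow_le_rpow (by positivity) hpowL hηpos.le
      have hden : 0 < η * Real.log 2 := mul_pos hηpos hlog2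
      exact h1.trans (div_le_div_of_nonneg_right h2 hden.le)
    -- (c) `(d+1)^c ≤ K n^{η c}` with `d = c₀ L`
    have hd_le : (I.1.d : ℝ) + 1 ≤ ((c₀ : ℝ) + 1) * ((L : ℝ) + 1) := by
      have : (I.1.d : ℝ) = c₀ * L := by rw [hI]; push_cast; ring
      rw [this]
      have hc₀ : (0 : ℝ) ≤ c₀ := Nat.cast_nonneg _
      have hL0 : (0 : ℝ) ≤ L := Nat.cast_nonneg _
      nlinarith
    have hc : ((I.1.d : ℝ) + 1) ^ c ≤ K * (n : ℝ) ^ (η * c) := by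
      have hden : 0 < η * Real.log 2 := mul_pos hηpos hlog2
      have h1 : (I.1.d : ℝ) + 1 ≤ ((c₀ : ℝ) + 1) / (η * Real.log 2) * (n : ℝ) ^ η := by
        calc (I.1.d : ℝ) + 1 ≤ ((c₀ : ℝ) + 1) * ((L : ℝ) + 1) := hd_le
          _ ≤ ((c₀ : ℝ) + 1) * ((n : ℝ) ^ η / (η * Real.log 2)) :=
              mul_le_mul_of_nonneg_left hb (by positivity)
          _ = ((c₀ : ℝ) + 1) / (η * Real.log 2) * (n : ℝ) ^ η := by ring
      have h2 := pow_le_pow_left₀ (by positivity) h1 c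
      rw [mul_pow, ← Real.rpow_natCast ((n : ℝ) ^ η) c, ← Real.rpow_mul hnpos'.le] at h2
      exact h2
    -- (d) `η c ≤ ε/2`, so `n^{2-ε} n^{η c} ≤ n^{2-ε/2}`
    have hηc : η * c ≤ ε / 2 := by
      rw [hη]
      rw [div_mul_eq_mul_div, div_le_div_iff₀ (by positivity) (by norm_num)]
      have hc0 : (0 : ℝ) ≤ c := Nat.cast_nonneg _
      nlinarith
    have he : (n : ℝ) ^ (2 - ε) * (n : ℝ) ^ (η * c) ≤ (n : ℝ) ^ (2 - ε / 2) := by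
      rw [← Real.rpow_add hnpos']
      exact Real.rpow_le_rpow_of_exponent_le hn1 (by linarith)
    -- assemble
    have hn2 : (0 : ℝ) ≤ (n : ℝ) ^ (2 - ε) := Real.rpow_nonneg hnpos'.le _
    have h22 : (0 : ℝ) ≤ (2 : ℝ) ^ (2 - ε) := Real.rpow_nonneg (by norm_num) _
    calc max C 0 * (((n : ℝ) + 1) ^ (2 - ε) * ((I.1.d : ℝ) + 1) ^ c)
        ≤ max C 0 * ((2 : ℝ) ^ (2 - ε) * (n : ℝ) ^ (2 - ε) * (K * (n : ℝ) ^ (η * c))) := by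
          apply mul_le_mul_of_nonneg_left _ hM0
          exact mul_le_mul ha hc hd0 (mul_nonneg h22 hn2)
      _ = max C 0 * (2 : ℝ) ^ (2 - ε) * K * ((n : ℝ) ^ (2 - ε) * (n : ℝ) ^ (η * c)) := by ring
      _ ≤ max C 0 * (2 : ℝ) ^ (2 - ε) * K * (n : ℝ) ^ (2 - ε / 2) :=
          mul_le_mul_of_nonneg_left he (by positivity)
      _ ≤ C' * (n : ℝ) ^ (2 - ε / 2) + C' := by
          have hK1 : max C 0 * (2 : ℝ) ^ (2 - ε) * K ≤ C' := by
            rw [hC']; linarith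
          have hr : (0 : ℝ) ≤ (n : ℝ) ^ (2 - ε / 2) := Real.rpow_nonneg hnpos'.le _
          have hC'0 : 0 ≤ C' := by rw [hC']; positivity
          nlinarith

/-- **OVH from the deterministic OV conjecture.** If OV had an `O((n+1)^{2-ε}(d+1)^c)` word-RAM
algorithm for some `ε > 0`, then (shrinking `ε` below `1`) OV in every dimension `d = c₀ ⌊log₂ n⌋`
would be in time `O(n^{2-ε/2})` (`ovWithDim_inTimeO_of_ovInTimePolyDim`), contradicting
`OVConjectureDet` at `ε/2`. So OVH (polynomial dimension) is the weaker hypothesis, as remarked in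
Bringmann–Künnemann, FOCS 2015, §2.1. [cite: BringmannKunnemannFOCS2015, §2.1] -/
theorem ovhWordRAM_of_ovConjectureDet (hOVC : OVConjectureDet) : OVHWordRAM := by
  intro ε hε hov
  set ε₁ : ℝ := min ε 1 with hε₁
  have hε₁pos : 0 < ε₁ := lt_min hε one_pos
  have hε₁le : ε₁ ≤ 1 := min_le_right _ _
  have hov₁ : OVInTimePolyDim ε₁ := hov.anti (min_le_left _ _)
  obtain ⟨c₀, -, hc₀⟩ := hOVC (ε₁ / 2) (by positivity)
  exact hc₀ (ovWithDim_inTimeO_of_ovInTimePolyDim hε₁pos hε₁le hov₁ c₀)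

/-- SETH ⇒ OVH on the word RAM also follows from fine-grained.S09 in the word-RAM model
(`ovConjectureDet_of_sethWordRAM : SETHWordRAM → OVConjectureDet`, VVW ICM 2018, Thm. 3.1), by
`ovhWordRAM_of_ovConjectureDet`. (That route needs the sparsification lemma; the direct route
`ovhWordRAM_of_sethWordRAM_of` does not.) [folklore] -/
theorem ovhWordRAM_of_sethWordRAM_of_ovConjectureDet (h : ovConjectureDet_of_sethWordRAM) :
    ovhWordRAM_of_sethWordRAM :=
  fun hSETH => ovhWordRAM_of_ovConjectureDet (h hSETH)

/-! ### Subquadratic binary edit distance ⇒ ¬ OVH (Backurs–Indyk; Bringmann–Künnemann) -/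

/-- **OV from subquadratic binary edit distance (named fact).** If for some `0 < ε ≤ 1` the edit
distance of two binary strings of total length `n` (`Cryptography.EditDistance`: output
`[editDist s t]`) is computable by a deterministic word-RAM program in time `O(n^{2-ε})`, then OV is
decidable on the deterministic word RAM within `O((n+1)^{2-ε} (d+1)^c)` steps (`OVInTimePolyDim ε`;
indeed `c = 2`). Printed forms: Backurs–Indyk, STOC 2015, Thm. 3 (arXiv numbering; the abstract's
theorem): "If `EDIT` can be computed in time `O(n^{2-δ})` for some `δ > 0` on two sequences of
length `n` over an alphabet of size `4`, then OV with `|A| = |B| = N` and `A, B ⊆ {0,1}^d` can be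
solved in time `d^{O(1)} · N^{2-δ}`" — via the vector gadgets of §3.1 (Lemmas 1–2), Thm. 1
(`PATTERN`) and Thm. 2 (`EDIT(P₁', P₂') = Y` iff no orthogonal pair, `≤ Y - (E_u - E_s)` otherwise);
for the **binary** alphabet of `EditDistance`: Bringmann–Künnemann, FOCS 2015, Thm. 3.3 and its
proof (§3.1: from `a₁…a_n, b₁…b_m ∈ {0,1}^d` build, in time `O((n+m) d)`, binary strings `x, y` of
length `O((n+m) d)` and a threshold `ρ` with `EDIT(x, y) ≤ ρ` iff an orthogonal pair exists —
Claims 3.4–3.6 — so an `O(M^{2-ε})` edit-distance algorithm decides OV with `n = m` in time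
`O((n d)^{2-ε})`), instantiated with the coordinate values of Lemma 5.2 (`11100, 10011, 00111,
11001`) and the alignment gadget of Lemmas 5.3–5.4 for `EDIT(c_subst)`, `c_subst = 1` (Levenshtein).
On the word RAM the OV program writes `x, y` in the format `encodeBoolPair`, runs the hypothetical
edit-distance program as an emulated sub-run at its own word size, and compares the result with
`ρ`; `ε ≤ 1` because writing `x, y` already costs `Θ(N d)` (module docstring).
[cite: BackursIndykSTOC2015, Thm. 3 (§3.3; with Thms. 1–2, Lemmas 1–2)]
[cite: BringmannKunnemannFOCS2015, Thm. 3.3 (proof §3.1) with Lemmas 5.2–5.4; Thm. 1.2] -/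
def ovInTimePolyDim_of_editDistance_inTimeO : Prop :=
  ∀ ε : ℝ, 0 < ε → ε ≤ 1 →
    (EditDistance.InTimeO fun n => (n : ℝ) ^ (2 - ε)) → OVInTimePolyDim ε

/-! ### Assembly -/

/-- **Binary edit distance is OVH-hard (assembled).** Bringmann–Künnemann, FOCS 2015, Thm. 1.2
for Levenshtein distance, with SETH replaced by OVH as the authors allow (§2.1: "we prove all of
our results by reductions from Orthogonal Vectors, so that in our results we may replace the
assumption SETH by OVH"): given the reduction `ovInTimePolyDim_of_editDistance_inTimeO`, OVH on
the word RAM rules out every deterministic `O(n^{2-ε})`-time word-RAM algorithm for binary edit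
distance, `ε > 0` (shrink `ε` to `min ε 1` first). [cite: BringmannKunnemannFOCS2015, Thm. 1.2 with §2.1] -/
theorem not_editDistance_inTimeO_of_ovhWordRAM (h₂ : ovInTimePolyDim_of_editDistance_inTimeO)
    (hOVH : OVHWordRAM) (ε : ℝ) (hε : 0 < ε) :
    ¬ EditDistance.InTimeO fun n => (n : ℝ) ^ (2 - ε) := by
  intro hED
  set ε₁ : ℝ := min ε 1 with hε₁
  have hε₁pos : 0 < ε₁ := lt_min hε one_pos
  have hε₁le : ε₁ ≤ 1 := min_le_right _ _
  have hED₁ : EditDistance.InTimeO fun n => (n : ℝ) ^ (2 - ε₁) :=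
    inTimeO_rpow_two_sub_anti (min_le_left _ _) hED
  exact hOVH ε₁ hε₁pos (h₂ ε₁ hε₁pos hε₁le hED₁)

/-- **Assembly of fine-grained.S14 in the word-RAM model (proved).** SETH ⇒ OVH
(`ovhWordRAM_of_sethWordRAM`; Williams 2005 / Bringmann–Künnemann 2015, Lemma 2.1) and
"subquadratic binary edit distance ⇒ ¬ OVH" (`ovInTimePolyDim_of_editDistance_inTimeO`;
Backurs–Indyk 2015, Thm. 3 / Bringmann–Künnemann 2015, Thm. 3.3 with §5.2) imply the printed
theorem `not_editDistance_inTimeO_of_sethWordRAM` (Backurs–Indyk, STOC 2015, Thm. 1 of the STOC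
version; binary alphabet: Bringmann–Künnemann, FOCS 2015, Thm. 1.2) verbatim.
[cite: BackursIndykSTOC2015, Thm. 1] [cite: BringmannKunnemannFOCS2015, Thm. 1.2] -/
theorem not_editDistance_inTimeO_of_sethWordRAM_of (h₁ : ovhWordRAM_of_sethWordRAM)
    (h₂ : ovInTimePolyDim_of_editDistance_inTimeO) :
    not_editDistance_inTimeO_of_sethWordRAM :=
  fun hSETH ε hε => not_editDistance_inTimeO_of_ovhWordRAM h₂ (h₁ hSETH) ε hε

/-- The same assembly from the two machine-level named facts of this file (Williams' reduction
and the edit-distance reduction), with no further hypothesis. [folklore] -/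
theorem not_editDistance_inTimeO_of_sethWordRAM_of' (h₁ : kSATInRAMTime_of_ovInTimePolyDim)
    (h₂ : ovInTimePolyDim_of_editDistance_inTimeO) :
    not_editDistance_inTimeO_of_sethWordRAM :=
  not_editDistance_inTimeO_of_sethWordRAM_of (ovhWordRAM_of_sethWordRAM_of h₁) h₂

end Literature.Computability.FineGrained
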